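import Mathlib
import Summits.ValiantsHypothesis.ValiantsHypothesis.Theorems.GrenetZeonTwoDimCoefficientsScalingCouplingSwap
import Summits.ValiantsHypothesis.ValiantsHypothesis.Theorems.GrenetZeonTwoDimCoefficientsScalingCouplingSwapLevel

/-!
# Crux `GrenetZeon.TwoDimCoefficients` (stmt-ValiantsHypothesis-8062) / rung `DualUnipotentThreeHalves` (stmt-24318):
# scaling-closure — ★★ INDEX-`n` PLUS ONE RANK-ONE EDGE: the 3/2 rung beyond nil-index `n` with FULL numerators

The per-free rate law (✓ p835784) and ✓ `cube_le_two_mul_sq_of_index` stop at nil-index `n`.  Here: a nilpotent linear pencil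
`N = N₀ + E` with `N₀ⁿ = 0` and ONE rank-one edge `E = u vᵀ` (`u` constant, `v` linear) that closes no cycle (`E·N₀^j·E = 0`,
which is what nilpotency of `N` forces when `u, v ≠ 0`) — e.g. two index-`n` Jordan chains glued into one chain of length `2n`,
nil-index up to `2n` — with an ARBITRARY linear numerator `M`.  Since `E·N₀^j·E = 0`,

  `tr(N^k·M) = tr(N₀^k·M) + Σ_{i<k} tr(N₀^i·E·N₀^{k−1−i}·M)`   (`trace_pow_add_rankOne_mul`),

and the second sum is the CUT TERM of the doubled two-level pencil `[[N₀, 0], [E, N₀]]` against the back-coupling `M`, whose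
coupling block `E` is rank one: ✓ `rank_hess0_cutTerm_le_of_rankOne_coupling` (p839184) prices it `≤ 2(2m+1)` once its high
companions vanish — and they do, being `tr(N^k·M) − tr(N₀^k·M) = 0 − 0` for `k ≥ n` under the representation constraints.  With the
rate law for `tr(N₀^{n−1}·M)` (through ✓ `sq_sub_mul_le_of_tracePowParts_add_rankPart`):

* ★★ `cube_le_of_indexPlusRankOne` — `per_n = tr(N^{n−1}M)`, `N = N₀ + u vᵀ` as above, constraints `tr(N^k M) = 0` (`k ≥ n`)
  ⟹ `(n² − 2(2m+1))·n ≤ 2m²`, i.e. `n³ ≤ 2m² + 2n(2m+1)`: the 3/2 rung for this class of nil-index up to `2n`.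

HONEST FRAMING: one rank-one edge beyond index `n`, full numerator; two or more edges bring transit scalars `vᵀN₀^a u'` that this
method does not price.  No stub is closed: `DualUnipotentBound`, crux 8062, the 24318 decl and `VP ≠ VNP` remain open.

References: T. Mignon, N. Ressayre, Int. Math. Res. Not. 2004:79, Thm. 1.1 (via the tree); folklore.
-/

-- single-conjunct layout `Summits/ValiantsHypothesis/ValiantsHypothesis`: the duplicated namespace
-- component is mandated by the tree.
set_option linter.dupNamespace false
set_option autoImplicit false

noncomputable section

namespace Summit.ValiantsHypothesis.ValiantsHypothesis.Theorems.GrenetZeonTwoDimCoefficients.ScalingClosure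

open MvPolynomial Matrix
open Literature.Computability.AlgebraicComplexity
open Summit.ValiantsHypothesis.ValiantsHypothesis.Cruxes.TwoDimCoefficients.DimTwoCases

section IndexPlusRankOne

variable {n m : ℕ}

/-- **One non-closing edge**: if `E·N₀^j·E = 0` for all `j`, then
`tr((N₀ + E)^k·M) = tr(N₀^k·M) + tr([[N₀,0],[E,N₀]]^k·[[0,M],[0,0]])` (the doubled two-level cut term). [folklore] -/
theorem trace_pow_add_rankOne_mul {R : Type*} [CommRing R] (N₀ E M : Matrix (Fin m) (Fin m) R)
    (hE : ∀ j, E * N₀ ^ j * E = 0) (k : ℕ) :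
    ((N₀ + E) ^ k * M).trace = (N₀ ^ k * M).trace + ((fromBlocks N₀ 0 E N₀) ^ k * fromBlocks 0 M 0 0).trace := by
  rw [add_pow_eq_of_mul_pow_mul_eq_zero N₀ E hE k, Matrix.add_mul, Matrix.trace_add, trace_fromBlocks_pow_mul_cut,
    Matrix.sum_mul, Matrix.trace_sum]

/-- ★★ **The 3/2 rung for index-`n` pencils with one rank-one edge and a full numerator.**  `N₀` linear with `N₀ⁿ = 0`,
`E = u vᵀ` (`u` constant, `v` linear) with `E·N₀^j·E = 0`, `M` linear, `per_n = tr((N₀ + E)^{n−1}·M)` and the representation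
constraints `tr((N₀ + E)^k·M) = 0` for `k ≥ n` (✓ `exists_constrained_pencil_of_dualUnipotentRepr`).  Then
`(n² − 2(2m+1))·n ≤ 2m²` (`n ≥ 2`). [cite: MignonRessayre2004, Thm. 1.1 — via the tree; folklore] -/
theorem cube_le_of_indexPlusRankOne (hn : 2 ≤ n) (N₀ M : AffMat n m)
    (hN₀ : ∀ i j, (N₀ i j).IsHomogeneous 1) (hM : ∀ i j, (M i j).IsHomogeneous 1) (hN₀n : N₀ ^ n = 0)
    (u : Fin m → ℂ) (v : Fin m → MvPolynomial (Fin n × Fin n) ℂ) (hv : ∀ j, (v j).IsHomogeneous 1)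
    (hE : ∀ j, vecMulVec (fun i => MvPolynomial.C (u i)) v * N₀ ^ j * vecMulVec (fun i => MvPolynomial.C (u i)) v = 0)
    (hper : perPoly (Fin n) ℂ = ((N₀ + vecMulVec (fun i => MvPolynomial.C (u i)) v) ^ (n - 1) * M).trace)
    (hconstr : ∀ k, n ≤ k → ((N₀ + vecMulVec (fun i => MvPolynomial.C (u i)) v) ^ k * M).trace = 0) :
    (n ^ 2 - 2 * (2 * m + 1)) * n ≤ 2 * m ^ 2 := by
  classical
  set E : AffMat n m := vecMulVec (fun i => MvPolynomial.C (u i)) v with hEdef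
  set Y : MvPolynomial (Fin n × Fin n) ℂ := ((fromBlocks N₀ 0 E N₀) ^ (n - 1) * fromBlocks 0 M 0 0).trace with hY
  -- the decomposition `per = tr(N₀^{n-1} M) + Y`
  have hsplit : perPoly (Fin n) ℂ = (∑ _i : Fin 1, MvPolynomial.C (1 : ℂ) * (N₀ ^ (n - 1) * M).trace) + Y := by
    rw [hper, trace_pow_add_rankOne_mul N₀ E M hE (n - 1), Fin.sum_univ_one, map_one, one_mul]
  -- high companions of the doubled cut term vanish
  have hhigh : ∀ k, n ≤ k → ((fromBlocks N₀ 0 E N₀) ^ k * fromBlocks 0 M 0 0).trace = 0 := by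
    intro k hk
    have h := trace_pow_add_rankOne_mul N₀ E M hE k
    obtain ⟨d, hd⟩ : ∃ d, k = n + d := ⟨k - n, by omega⟩
    rw [hconstr k hk, hd, pow_add, hN₀n, Matrix.zero_mul, Matrix.zero_mul, Matrix.trace_zero, zero_add, ← hd] at h
    exact h.symm
  -- the cut term is priced by the rank-one coupling theorem
  have hN₀m : N₀ ^ m = 0 :=
    Summit.ValiantsHypothesis.ValiantsHypothesis.Theorems.GrenetZeon.SlowCore.pow_card_eq_zero_of_pow_eq_zero N₀ hN₀n
  set z : Fin n × Fin n → ℂ := fun w => if w.1 = (1 : Equiv.Perm (Fin n)) w.2 then (1 : ℂ) else 0 with hz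
  have hrankY : (hess0 (transl z Y)).rank ≤ 2 * (2 * m + 1) := by
    have h := rank_hess0_cutTerm_le_of_rankOne_coupling hn N₀ N₀ hN₀ hN₀ hN₀m hN₀m u v hv M hM hhigh z
    rw [Fintype.card_fin] at h
    calc (hess0 (transl z Y)).rank ≤ 2 * (m + m + 1) := h
      _ = 2 * (2 * m + 1) := by ring
  -- the ledger with one index-`n` constituent and the rank-priced part `Y`
  have hmain := sq_sub_mul_le_of_tracePowParts_add_rankPart hn (fun _ : Fin 1 => m) (fun _ => N₀) (fun _ => M)
    (fun _ => (1 : ℂ)) (fun _ => hN₀) (fun _ => hM) (fun _ => hN₀n) (fun _ => hN₀m) Y 1 (2 * (2 * m + 1)) hrankY hsplit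
  simpa using hmain

end IndexPlusRankOne

end Summit.ValiantsHypothesis.ValiantsHypothesis.Theorems.GrenetZeonTwoDimCoefficients.ScalingClosure

end
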